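import Mathlib
import HarnessLib
import Literature.MathematicalPhysics.QuantumLattice.KohnLuttinger
import Summits.HubbardSuperconductivity.HubbardSuperconductivity.Theorems.WeakCouplingBCSDefs
import Summits.HubbardSuperconductivity.HubbardSuperconductivity.Theorems.WeakCouplingBCSDefsKlU0Record

/-!
# Route `WeakCouplingBCS` — channel-margin lane of `WcbcsKohnLuttingerB1g` (stmt-HubbardSuperconductivity-0158): the OBJECTS behind
# the explicit-`U₀` rows — the third-order particle–particle-irreducible Cooper vertex at `T = 0` and its channel forms

The `U₀` rows of `Theorems/WeakCouplingBCSDefsKlU0Record.lean` (`KLU0Row`, soundness `klU0Row_sound`) are stated for ARBITRARY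
real functions `lamB, lamX` of the coupling: their expansion bounds are named hypotheses, but the objects those bounds are ABOUT —
the third-order kernel of the pp-irreducible vertex and its channel bottoms — had no tree definition (cell file
`run/shared/lean/pub/gate-hubbard-kl/U0-TABLE.md` v0 §4.3 (a)).  This file supplies them, so that a row becomes a statement about
explicit integrals (companion file `WeakCouplingBCSKlThirdOrderSelection.lean`).

Setting (tree units): dispersion `ε`, level `μ`, `ξ = ε - μ`, momentum integrals `∫_{BZ} d²p/(2π)²`, Fermi-curve measure
`σ_μ = fermiCurveMeasure ε μ`, static Lindhard function `χ₀ = lindhardFunction ε μ` (`KohnLuttinger.lean`).  The opposite-spin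
particle–particle-irreducible static Cooper vertex of the Hubbard model through third order is
`Γ_U(k,k') = U + U² χ₀(k+k') + U³ K₃(k,k') + O(U⁴)`,
`K₃ = χ₀(k-k')² + χ₀(k+k')² + T_V + T_P`:
the two CHAIN topologies (longitudinal bubble chain, crossed ladder; Raghu–Kivelson–Scalapino 2010, App. A, diagrams (3d), (3a))
and the two genuinely two-loop ones — `T_V`, the bubble-exchange vertex correction with a fermion loop of either spin (diagrams
(3e)–(3f)), and `T_P`, the particle–particle-bubble insertion in the crossed channel and its mirror (diagrams (3b)–(3c)).  The
frequency integrals of the two-loop diagrams are done at `T = 0` by residues (cell file U0-TABLE.md v1 §1′, validated numerically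
against finite-temperature Matsubara sums and an independent `s`-representation): with the particle–hole PAIR MEASURE at transfer
`u` (push-forward of `d²p'/(2π)²` on `{ξ(p') < 0 < ξ(p'+u)}` under `D = ξ(p'+u) - ξ(p')`) and its Stieltjes transform
`R_u(A) = ∫ dm_u(D)/(D + A)`, `T_V(k,k') = 2 ∫ d²u/(2π)² Ψ_V(u; ξ(u-k), ξ(u-k'))` where `Ψ_V(u; a, b) = -R̃_u[a,b]` is minus the
divided difference of `R̃_u(x) = sign(x) R_u(|x|)`; explicitly `Ψ_V = ∫ dm_u(D) J_V(D; a, b)` with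
`J_V = 1/((D+|a|)(D+|b|))` for `ab > 0` (a positive-semidefinite Loewner kernel) and `J_V = -(1/(D+|a|) + 1/(D+|b|))/(|a|+|b|)` for
`ab < 0`.  Likewise `T_P` with the occupied-pair and empty-pair measures at total momentum `u` (pair energies
`E = -ξ(q) - ξ(u-q)` resp. `ξ(q) + ξ(u-q)`), arguments `a = ξ(u+k)`, `b = ξ(u-k')` (crossed channel), symmetrised over `k ↔ k'`
(the mirror diagram is the transpose).  These are EXACTLY the formulas of the cell's float code of record (margin-1 g2 `t0/main.py`)
and of the certified bound chain (margin-1 g5/g6, U0-TABLE v2 §1), whose allowances `tB`, `t(χ)` bound the forms of `T_V + T_P`.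

Contents: the generic kernel quadratic form `kform`; `jV`, `psiV`, `twoLoopV`; `jOcc`, `jEmp`, `psiP`, `twoLoopP`; the chain kernel
`chainKernel3`; `klThirdOrderKernel = K₃`; the truncated vertex form `thirdOrderForm ε μ U ψ = (∫ψ dσ)²/U + ⟨ψ, χ₀(k+k') ψ⟩ + U ⟨ψ, K₃ ψ⟩`
(`= ⟨ψ, (Γ_U/U²) ψ⟩` through third order; the bare `U` is the constant kernel) and its channel bottoms `channelInf3`; and the two
NAMED third-order hypotheses of a `KLU0Row` at a level `μ` for the square-lattice band `ε₀ = squareDispersion 1 0`: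
`KLU0Row.B1gThirdOrderBound` (the `B1g` Ritz side: `⟨Φ_B, K₃ Φ_B⟩ ≤ (c3B + tB) ‖Φ_B‖²` for the record trial) and
`KLU0Chan.ThirdOrderLowerBound` (a competitor: `⟨ψ, K₃ ψ⟩ ≥ -(s3 + t)` on its normalised channel states), bundled as
`KLU0Row.ThirdOrderEnclosures` (with `KLU0Row.chanOf`, the row's datum per channel), plus the kernel-decidable consistency check
`KLU0Row.dominates` of a row against a second-order record box — the two bounds are the inequalities the
cell's certified computations deliver (chains: kit j247393/j247690; two-loop floor: U0-TABLE v2–v3), with the elementary identities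
`⟨ψ, χ₀(k-k')² ψ⟩ = ⟨ψ, χ₀(k+k')² ψ⟩` on even `ψ`, `= -⟨ψ, χ₀(k+k')² ψ⟩` on odd `ψ` (inversion symmetry of `σ_μ`) and
`⟨ψ, T_P ψ⟩ = ±⟨ψ, S_P ψ⟩` on parity-definite `ψ` relating them to the quantities tabulated there.

Deliberately NOT here: the resummed bubble/ladder chains of order `≥ 4` (the rows' `c4B`, `s4`; Scalapino–Loh–Hirsch 1986) and the
non-chain remainder of order `≥ 4` (the rows' ASSUMED `C4`) — the companion theorem uses a row only through third order; no claim
that the Bochner integrals below converge is made here (junk value `0` otherwise, as for `lindhardFunction`); nothing in this file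
asserts a pairing instability.

References: S. Raghu, S. A. Kivelson, D. J. Scalapino, Phys. Rev. B 81 (2010) 224505 (arXiv:1002.0591), §V eq. (25) and App. A
(third-order two-particle-irreducible diagrams (3a)–(3f)); W. Kohn, J. M. Luttinger, Phys. Rev. Lett. 15 (1965) 524;
D. J. Scalapino, E. Loh, J. E. Hirsch, Phys. Rev. B 34 (1986) 8190.
-/

noncomputable section

-- the tree's namespace `Summit.<Summit>.<Problem>.Theorems` repeats the summit name by design (D-0017)
set_option linter.dupNamespace false

namespace Summit.HubbardSuperconductivity.HubbardSuperconductivity.Theorems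

open MeasureTheory Real Literature.MathematicalPhysics.QuantumLattice CwKLChiralWindow

namespace KlThirdOrder

/-! ### Generic kernel quadratic form -/

/-- The quadratic form of a kernel `K` against a measure `σ` on momentum space:
`kform σ K ψ = ∫ ψ(k) (∫ K(k,k') ψ(k') dσ(k')) dσ(k)` (Bochner integrals; `pairingForm ε μ U` is `kform` of the
Kohn–Luttinger kernel `U + U² χ₀(k+k')` against `fermiCurveMeasure ε μ`). [folklore] -/
def kform (σ : Measure Momentum) (K : Momentum → Momentum → ℝ) (ψ : Momentum → ℝ) : ℝ :=
  ∫ k, ψ k * ∫ k', K k k' * ψ k' ∂σ ∂σ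

/-- The second-order kernel `χ₀(k + k')` (the `U²` coefficient of the Kohn–Luttinger vertex) as a two-argument kernel.
[cite: RaghuKivelsonScalapino2010, §II (7)] -/
def lindhardKernel (ε : Momentum → ℝ) (μ : ℝ) (k k' : Momentum) : ℝ :=
  lindhardFunction ε μ (k + k')

/-! ### The bubble-exchange vertex correction `T_V` (RKS App. A, diagrams (3e)–(3f)) at `T = 0` -/

/-- The `T = 0` frequency integral of the vertex-correction diagram against one atom of the particle–hole pair measure:
for pair energy `D > 0` and outer energies `a = ξ(u-k)`, `b = ξ(u-k')`,
`J_V(D; a, b) = 1/((D+|a|)(D+|b|))` if `ab > 0` (same side of the Fermi curve; a Loewner/Pick product kernel, positive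
semidefinite) and `J_V(D; a, b) = -(1/(D+|a|) + 1/(D+|b|))/(|a|+|b|)` otherwise (opposite sides; `≤ 0`, bounded) — minus the
divided difference at `(a, b)` of `x ↦ sign(x) ∫ dm(D)/(D+|x|)` (junk `0/0 = 0` at `a = b = 0`, a null set of the `u`-integral).
Cell file U0-TABLE.md v1 §1′ (i)–(iii).
[cite: RaghuKivelsonScalapino2010, App. A (3e)] -/
def jV (D a b : ℝ) : ℝ :=
  if 0 < a * b then 1 / ((D + |a|) * (D + |b|)) else -(1 / (D + |a|) + 1 / (D + |b|)) / (|a| + |b|)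

/-- `Ψ_V(u; a, b) = ∫_{BZ} d²p'/(2π)² 𝟙[ξ(p') < 0 < ξ(p'+u)] · J_V(ξ(p'+u) - ξ(p'); a, b)`: the vertex-correction integrand at
total transfer `u`, i.e. `∫ dm_u(D) J_V(D; a, b)` against the particle–hole pair measure `m_u` at transfer `u` (total mass
`χ₀(u)`). [cite: RaghuKivelsonScalapino2010, App. A (3e)] -/
def psiV (ε : Momentum → ℝ) (μ : ℝ) (u : Momentum) (a b : ℝ) : ℝ :=
  (∫ p in brillouinZone,
      if ε p < μ ∧ μ < ε (p + u) then jV (ε (p + u) - ε p) a b else 0) / (2 * π) ^ 2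

/-- **The two-loop vertex-correction kernel** `T_V(k, k') = 2 ∫_{BZ} d²u/(2π)² Ψ_V(u; ξ(u-k), ξ(u-k'))` (both spin
orientations of the fermion loop; symmetric in `k, k'`), `ξ = ε - μ`. [cite: RaghuKivelsonScalapino2010, App. A (3e)] -/
def twoLoopV (ε : Momentum → ℝ) (μ : ℝ) (k k' : Momentum) : ℝ :=
  2 * (∫ u in brillouinZone, psiV ε μ u (ε (u - k) - μ) (ε (u - k') - μ)) / (2 * π) ^ 2

/-! ### The crossed-channel particle–particle insertion `T_P` (RKS App. A, diagrams (3b)–(3c)) at `T = 0` -/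

/-- Frequency integral of the crossed pp-insertion against one atom of the OCCUPIED-pair measure (pair energy `E > 0` below
the Fermi level), outer energies `a, b`: `1/((E+a)(E+b))` if `a, b > 0`; `-1/((E + max a b)(|a|+|b|))` if `ab < 0` (only the
positive argument sees the occupied pairs); `0` if `a, b < 0`.  U0-TABLE.md v1 §1′ (ii).
[cite: RaghuKivelsonScalapino2010, App. A (3b)] -/
def jOcc (E a b : ℝ) : ℝ :=
  if 0 < a ∧ 0 < b then 1 / ((E + a) * (E + b))
  else if a * b < 0 then -(1 / ((E + max a b) * (|a| + |b|))) else 0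

/-- Frequency integral of the crossed pp-insertion against one atom of the EMPTY-pair measure (pair energy `E > 0` above the
Fermi level): `1/((E+|a|)(E+|b|))` if `a, b < 0`; `-1/((E - min a b)(|a|+|b|))` if `ab < 0` (only the negative argument sees the
empty pairs); `0` if `a, b > 0`.  U0-TABLE.md v1 §1′ (ii). [cite: RaghuKivelsonScalapino2010, App. A (3b)] -/
def jEmp (E a b : ℝ) : ℝ :=
  if a < 0 ∧ b < 0 then 1 / ((E + |a|) * (E + |b|))
  else if a * b < 0 then -(1 / ((E - min a b) * (|a| + |b|))) else 0

/-- `Ψ_P(u; a, b) = ∫_{BZ} d²q/(2π)² { 𝟙[ξ(q) < 0, ξ(u-q) < 0] J_occ(-ξ(q)-ξ(u-q); a, b) + 𝟙[ξ(q) > 0, ξ(u-q) > 0] J_emp(ξ(q)+ξ(u-q); a, b) }`: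
minus the divided difference at `(a, b)` of `x ↦ Q⁻_u(x)` (`x > 0`), `-Q⁺_u(-x)` (`x < 0`), `Q^∓_u` the Stieltjes transforms of the
occupied-pair / empty-pair measures at total momentum `u` (jump at `0` = the particle–particle bubble `K_pp(u, 0)`, the Cooper logarithm
as `u → 0`). [cite: RaghuKivelsonScalapino2010, App. A (3b)] -/
def psiP (ε : Momentum → ℝ) (μ : ℝ) (u : Momentum) (a b : ℝ) : ℝ :=
  (∫ q in brillouinZone,
      ((if ε q < μ ∧ ε (u - q) < μ then jOcc (2 * μ - ε q - ε (u - q)) a b else 0) +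
        (if μ < ε q ∧ μ < ε (u - q) then jEmp (ε q + ε (u - q) - 2 * μ) a b else 0))) / (2 * π) ^ 2

/-- **The two-loop crossed particle–particle kernel** (diagram (3b) plus its mirror (3c) = transpose), symmetrised:
`T_P(k, k') = ∫_{BZ} d²u/(2π)² [Ψ_P(u; ξ(u+k), ξ(u-k')) + Ψ_P(u; ξ(u+k'), ξ(u-k))]`.  On parity-definite `ψ` (`ψ(-k) = ±ψ(k)`) its
form equals `±` that of `S_P(k,k') = 2 ∫ Ψ_P(u; ξ(u-k), ξ(u-k'))`. [cite: RaghuKivelsonScalapino2010, App. A (3b)] -/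
def twoLoopP (ε : Momentum → ℝ) (μ : ℝ) (k k' : Momentum) : ℝ :=
  (∫ u in brillouinZone,
      (psiP ε μ u (ε (u + k) - μ) (ε (u - k') - μ) + psiP ε μ u (ε (u + k') - μ) (ε (u - k) - μ))) / (2 * π) ^ 2

/-! ### The third-order kernel and the truncated vertex form -/

/-- The third-order CHAIN kernel `χ₀(k - k')² + χ₀(k + k')²` (longitudinal bubble chain (3d) + crossed ladder (3a)).
[cite: RaghuKivelsonScalapino2010, App. A (3a)] -/
def chainKernel3 (ε : Momentum → ℝ) (μ : ℝ) (k k' : Momentum) : ℝ :=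
  lindhardFunction ε μ (k - k') ^ 2 + lindhardFunction ε μ (k + k') ^ 2

/-- **The third-order kernel of the particle–particle-irreducible Cooper vertex** (the `U³` coefficient of `Γ_U(k,k')`):
`K₃ = χ₀(k-k')² + χ₀(k+k')² + T_V + T_P` — the six pp-irreducible topologies among the nine tadpole-free connected amputated
third-order topologies (RKS App. A (3a)–(3f)). [cite: RaghuKivelsonScalapino2010, App. A] -/
def klThirdOrderKernel (ε : Momentum → ℝ) (μ : ℝ) (k k' : Momentum) : ℝ :=
  chainKernel3 ε μ k k' + twoLoopV ε μ k k' + twoLoopP ε μ k k'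

/-- **The truncated vertex form.** For `U > 0` and a gap function `ψ` on the Fermi curve,
`thirdOrderForm ε μ U ψ = (∫ ψ dσ_μ)²/U + ⟨ψ, χ₀(k+k') ψ⟩ + U ⟨ψ, K₃ ψ⟩` — the quadratic form of `Γ_U/U² = 1/U + χ₀(k+k') + U K₃(k,k')`,
the pp-irreducible vertex through third order divided by `U²` (the bare repulsion is the constant kernel; it is felt by `A1g` only;
meant for `U > 0`, junk `x/0 = 0` at `U = 0`).
[cite: RaghuKivelsonScalapino2010, §V (25)] -/
def thirdOrderForm (ε : Momentum → ℝ) (μ U : ℝ) (ψ : Momentum → ℝ) : ℝ :=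
  (∫ k, ψ k ∂fermiCurveMeasure ε μ) ^ 2 / U + kform (fermiCurveMeasure ε μ) (lindhardKernel ε μ) ψ +
    U * kform (fermiCurveMeasure ε μ) (klThirdOrderKernel ε μ) ψ

/-- **Third-order channel bottom**: `inf` of the truncated vertex form over the normalised gap functions of the symmetry channel
`χ` (`IsChannelState`; `sInf` in `ℝ`, junk `0` on an empty or unbounded-below set, as for `channelInf`).
[cite: RaghuKivelsonScalapino2010, §II (13)] -/
def channelInf3 (ε : Momentum → ℝ) (μ U : ℝ) (χ : D4Irrep) : ℝ :=
  sInf (thirdOrderForm ε μ U '' {ψ | IsChannelState ε μ χ ψ})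

/-! ### Elementary properties -/

/-- Pulling a scalar out of a kernel form: `kform σ K (c • Φ) = c² kform σ K Φ`. [folklore] -/
theorem kform_smul (σ : Measure Momentum) (K : Momentum → Momentum → ℝ) (Φ : Momentum → ℝ) (c : ℝ) :
    kform σ K (fun k => c * Φ k) = c ^ 2 * kform σ K Φ := by
  unfold kform
  have hin : ∀ k, ∫ k', K k k' * (c * Φ k') ∂σ = c * ∫ k', K k k' * Φ k' ∂σ := by
    intro k
    rw [← integral_const_mul]
    refine integral_congr_ae (Filter.Eventually.of_forall fun k' => ?_)
    ring
  simp_rw [hin]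
  rw [← integral_const_mul]
  refine integral_congr_ae (Filter.Eventually.of_forall fun k => ?_)
  ring

/-- The same-side vertex-correction integrand is non-negative: `J_V(D; a, b) ≥ 0` for `ab > 0`, `D ≥ 0`. [folklore] -/
theorem jV_nonneg_of_pos {D a b : ℝ} (hD : 0 ≤ D) (hab : 0 < a * b) : 0 ≤ jV D a b := by
  unfold jV
  rw [if_pos hab]
  have ha : 0 ≤ D + |a| := add_nonneg hD (abs_nonneg a)
  have hb : 0 ≤ D + |b| := add_nonneg hD (abs_nonneg b)
  positivity

/-- The opposite-side vertex-correction integrand is non-positive: `J_V(D; a, b) ≤ 0` for `ab ≤ 0`, `D ≥ 0`. [folklore] -/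
theorem jV_nonpos_of_nonpos {D a b : ℝ} (hD : 0 ≤ D) (hab : a * b ≤ 0) : jV D a b ≤ 0 := by
  unfold jV
  rw [if_neg (not_lt.mpr hab)]
  have ha : 0 ≤ D + |a| := add_nonneg hD (abs_nonneg a)
  have hb : 0 ≤ D + |b| := add_nonneg hD (abs_nonneg b)
  have h1 : 0 ≤ 1 / (D + |a|) + 1 / (D + |b|) := by positivity
  have h2 : 0 ≤ |a| + |b| := by positivity
  exact div_nonpos_of_nonpos_of_nonneg (neg_nonpos.mpr h1) h2

/-- The chain kernel is non-negative. [folklore] -/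
theorem chainKernel3_nonneg (ε : Momentum → ℝ) (μ : ℝ) (k k' : Momentum) : 0 ≤ chainKernel3 ε μ k k' := by
  unfold chainKernel3; positivity

end KlThirdOrder

/-! ### The named third-order hypotheses of a `U₀` row (square-lattice band `ε₀ = squareDispersion 1 0`) -/

open KlThirdOrder

/-- **`B1g`-side third-order hypothesis of a row** at the level `μ`, for the `B1g` Ritz trial `Φ` of the second-order record:
`⟨Φ, K₃ Φ⟩_{σ_μ} ≤ (c3B + tB) · ∫ Φ² dσ_μ` — the row's chain datum `c3B` (certified, `≥ ⟨Φ, 2χ₀(k+k')² Φ⟩/‖Φ‖²`, which equals the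
chain form on even `Φ`) plus its two-loop allowance `tB` (`≥ ⟨Φ, (T_V + T_P) Φ⟩/‖Φ‖²`; certified floor or float, as recorded with the
row). [folklore] -/
def KLU0Row.B1gThirdOrderBound (r : KLU0Row) (μ : ℝ) (Φ : Momentum → ℝ) : Prop :=
  kform (fermiCurveMeasure (squareDispersion 1 0) μ) (klThirdOrderKernel (squareDispersion 1 0) μ) Φ ≤
    (((r.c3B + r.tB : ℚ) : ℝ)) * ∫ k, Φ k ^ 2 ∂fermiCurveMeasure (squareDispersion 1 0) μ

/-- **Competitor-side third-order hypothesis of a row's channel datum** `c` read in the channel `χ` at the level `μ`: on every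
normalised gap function of the channel, `⟨ψ, K₃ ψ⟩_{σ_μ} ≥ -(s3 + t)` — the row's Hilbert–Schmidt bound `s3` of the (deflated)
third-order chain kernel in the channel (`inf spec ≥ -‖· - D‖_HS`, `D ≥ 0`; `0` on `E`, where the two chain terms cancel on odd
functions) plus its two-loop allowance `t ≥ -inf spec P_χ (T_V + T_P) P_χ`. [folklore] -/
def KLU0Chan.ThirdOrderLowerBound (c : KLU0Chan) (μ : ℝ) (χ : D4Irrep) : Prop :=
  ∀ ψ : Momentum → ℝ, IsChannelState (squareDispersion 1 0) μ χ ψ →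
    -(((c.s3 + c.t : ℚ) : ℝ)) ≤ kform (fermiCurveMeasure (squareDispersion 1 0) μ) (klThirdOrderKernel (squareDispersion 1 0) μ) ψ


/-- The competitor datum of a row for the channel `χ`, in the FIXED order `[A1g, A2g, B2g, E]` in which every row of the tree lists
its `chans` (generator `u0rows*.py`); a dummy datum for `B1g` or beyond the end of the list. [folklore] -/
def KLU0Row.chanOf (r : KLU0Row) : D4Irrep → KLU0Chan
  | .A1g => r.chans.getD 0 ⟨"", 0, 0, 0, 0⟩
  | .A2g => r.chans.getD 1 ⟨"", 0, 0, 0, 0⟩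
  | .B1g => ⟨"", 0, 0, 0, 0⟩
  | .B2g => r.chans.getD 2 ⟨"", 0, 0, 0, 0⟩
  | .E => r.chans.getD 3 ⟨"", 0, 0, 0, 0⟩

/-- **The named third-order hypotheses of a row at the level `μ`** (with `Φ` the `B1g` Ritz trial of the second-order record):
the `B1g`-side bound `B1gThirdOrderBound` and, for each of `A1g, A2g, B2g, E`, the competitor-side bound `ThirdOrderLowerBound` of
the row's datum for that channel.  For the rows of `WeakCouplingBCSDefsKlU0Record.lean` these are the statements delivered by the
cell's certified computations (chains in two interval implementations; two-loop allowances: certified floor for the `certfloor` rows,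
FLOATS for the `float`/`t0float` rows — as each row's docstring records). [folklore] -/
def KLU0Row.ThirdOrderEnclosures (r : KLU0Row) (μ : ℝ) (Φ : Momentum → ℝ) : Prop :=
  r.B1gThirdOrderBound μ Φ ∧ ∀ χ : D4Irrep, χ ≠ D4Irrep.B1g → (r.chanOf χ).ThirdOrderLowerBound μ χ

/-- **Consistency of a row with a second-order record box** (kernel-decidable): the row's `B1g` datum `rhohi` dominates the box's
Ritz bound, its four competitor data `low` are dominated by the box's certified lower bounds `KLBlock.lower`, the row lists exactly
four competitors, and `U1 ≤ 1` (the bare-`U` comparison `1/U ≥ 1` is used on `A1g`). [folklore] -/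
def KLU0Row.dominates (r : KLU0Row) (bx : KLBox) (tab : List KLTrig) : Bool :=
  decide (bx.bB1g.rhohi ≤ r.rhohi) && decide (r.chans.length = 4) && decide (r.U1 ≤ 1) &&
    decide ((r.chanOf .A1g).low ≤ bx.bA1g.lower tab .A1g) && decide ((r.chanOf .A2g).low ≤ bx.bA2g.lower tab .A2g) &&
    decide ((r.chanOf .B2g).low ≤ bx.bB2g.lower tab .B2g) && decide ((r.chanOf .E).low ≤ bx.bE.lower tab .E)


end Summit.HubbardSuperconductivity.HubbardSuperconductivity.Theorems

end
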